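/-
Copyright (c) 2026 the pub-hodgecm-mathlib formalisation cell (harness21).  Prover seat hodgecm-mathlib-K2E3-p28 (g2), HCML Track B «K2-LIT» ∕ h413
(`stmt-HodgeConjecture-24833`), line `K2_E3_EllipticInputs`, L4 `stub_StCharTS`, PART «LIE3b» ED. 1 letter (LAU-pt): from the DISTRIBUTIONAL identity
`∫ f · (Θ₀ ∘ cay) dμ𝔤 = T(𝓕f)` on an open Cayley domain `V ⊂ 𝔲(σ_w, H_w)` to the POINTWISE identity `Θ₀(cay Y) = F_T(Y)` at regular `Y ∈ V` (every `N`).  2026-09-04.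
-/
import Summits.HodgeConjecture.HodgeConjecture.Theorems.K2E3ULieCharExpansionAtOneFinDim   -- ★ p861546 (this seat): `exists_isCompact_isOpen_mem_subset_lie`; brings ★ p856651 GL-twin kit (`discr_charpoly_cayley_mul_det_pow`, `integral_indicator_one_mul_eq_of_eqOn`, `isLocSmooth_indicator`, `isRegularElt_iff_isUnit_discr`), ★ p857403 (F1) (`lieOfForm`, `lieFourier`, `galAdicCompletionMap`)
import HarnessLib

/-!
# K2_E3 road (h413), PART «LIE3b» letter (LAU-pt) — the pointwise (L-A_U)′ identity from the distributional one on an open Cayley domain, every `N`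

Cell `pub/hodgecm-mathlib` (D-0151), Track B (21-frontier RULING «PUSH BOTH» 2026-09-03, director req624, CLOSE-OUT ROSTER l.72907 strike line L4 `stub_StCharTS`),
seat K2E3-p28 (g2).  `--supports stmt-HodgeConjecture-24833 --as helper`; THEOREMS ONLY (no definition ∕ instance ∕ notation ∕ named fact ∕ `sorry`); never imports
`Cruxes/…/Lines`.  PAYS the hosted letter (LAU-pt) `U12Characters.sig_K2E3ULieCharExpansionAtOneOfDistribution` of PART «LIE3b» ED. 1 (K2E3-typ4 (g0) cand
sha16 cc262bdfb6b2b155 :181) BY NAME: the statement of `uLieCharExpansionAtOne_of_distribution` below is that socket's statement BYTE FOR BYTE.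

MATHEMATICS [HarishChandra1999, Thm. 16.3 p. 77, §21 p. 87].  The (L-A_U)′ conclusion is pointwise: `Θ_{r₀}(c(Y)) = F_T(Y)` for regular `Y` near `0`, `c(Y) =
(1+Y)(1−Y)⁻¹` the Cayley map.  Harish-Chandra's theorem (letter (LAU-dist), §21) delivers it as an identity of DISTRIBUTIONS on an open Cayley domain `V`:
`∫ f · Θ𝔤 dμ𝔤 = T(𝓕f)` for every `f ∈ C_c^∞(𝔲)` supported in `V` and every `Θ𝔤` agreeing with `Θ_{r₀} ∘ c` on `𝔲 ∩ V`.  If `T̂` is represented by a function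
`F_T` (`T(𝓕f) = ∫ f · F_T`) locally constant at the regular `Y`, the pointwise identity follows by testing against the indicator `1_S` of a small compact open
`S ∋ Y` of `↥𝔲` (★ `exists_isCompact_isOpen_mem_subset_lie`) on which BOTH sides are constant: `μ𝔤(S) · Θ_{r₀}(c(Y)) = ∫ 1_S Θ𝔤 = T(𝓕 1_S) = ∫ 1_S F_T = μ𝔤(S) · F_T(Y)`
and `0 < μ𝔤(S) < ∞` (additive Haar).  Constancy of `Θ_{r₀} ∘ c` near `Y`: `c(Y)` is regular semisimple when `Y` is (★ `discr_charpoly_cayley_mul_det_pow`,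
`char L_w = 0`), `Θ_{r₀}` is locally constant at regular points, and the Cayley map is continuous at `Y` INTO `U(σ_w, H_w)(L_w) ≤ GL_N(L_w)` (units topology `g ↦ (g, g⁻¹)`,
`c(Z)⁻¹ = (1−Z)(1+Z)⁻¹`, matrix inversion continuous at the invertible `1 ± Y` — §1 `cayley_mem_nhds`, the general-base-point form of ★ `cayley_mem_nhds_one`).
* §1 `cayley_mem_nhds` — pull-back of a neighbourhood of `c(Y₀) ∈ GL_N(F)` along the Cayley map to a neighbourhood of `Y₀ ∈ M_N(F)` (`1 ± Y₀` invertible).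
* §2 **`uLieCharExpansionAtOne_of_distribution`** — the letter (LAU-pt) VERBATIM (`Θ𝔤 := Y ↦ Θ₀(the g with matrix c(Y))` on `V`, `0` off `V`, by choice from the
  Cayley-domain clause; the AGREE clause holds because an element of `U(σ_w, H_w)(L_w)` is determined by its matrix).
[HarishChandra1999AdmissibleDistributions, Thm. 16.3 p. 77, §21 p. 87] [Howe1974, Prop. 3] [PlatonovRapinchuk1994, §3.3].
HONEST LABEL: HC_CM is proved only modulo the 7 printed citations (2 remaining named inputs: hLiu418 = stmt-HodgeConjecture-24832, h413 =
stmt-HodgeConjecture-24833) until rung 0 closes; count-neutral helper ((LAU-pt) is the pointwise-from-distributional step of (L-A_U)′; the core (LAU-dist) stays OPEN;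
nothing here is on the `stub_StCharTS` sorry count until the dealer ties PART «LIE3b»).

## References
* [HarishChandra1999AdmissibleDistributions] Harish-Chandra (DeBacker–Sally), *Admissible Invariant Distributions on Reductive p-adic Groups* (1999), Thm. 16.3, §21.
* [Howe1974] R. Howe, *The Fourier transform and germs of characters (case of GL_n over a p-adic field)*, Math. Ann. 208 (1974), Prop. 3.
* [PlatonovRapinchuk1994] V. Platonov, A. Rapinchuk, *Algebraic Groups and Number Theory* (1994), §2.3, §3.3 (Cayley map, units topology).
-/

set_option autoImplicit false
set_option linter.dupNamespace false   -- `Summit.HodgeConjecture.HodgeConjecture.…` (D-0017 nested layout; lakefile exemption for Summits)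

noncomputable section

open MeasureTheory Filter Topology NumberField IsDedekindDomain
open scoped Matrix MatrixGroups NNReal
open Literature.NumberTheory.Rogawski1990 Literature.NumberTheory.Automorphic Literature.NumberTheory.Automorphic.UnitaryGroup
open Literature.NumberTheory.GaloisRepresentations Literature.NumberTheory.GaloisRepresentations.IsNonarchimedeanLocalField
open Summit.HodgeConjecture.HodgeConjecture.Cruxes.H413.K2E3LieUnitary
open Summit.HodgeConjecture.HodgeConjecture.Cruxes.H413.K2E3NormalizedCharBddNearSemisimpleRegular
open Summit.HodgeConjecture.HodgeConjecture.Cruxes.H413.K2E3CharLocBddOfLocal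
open Summit.HodgeConjecture.HodgeConjecture.Cruxes.H413.K2E3CayleyCharpolyDiscr
open Summit.HodgeConjecture.HodgeConjecture.Cruxes.H413.K2E3ULieCharExpansionAtOneFinDim

namespace Summit.HodgeConjecture.HodgeConjecture.Cruxes.H413.K2E3ULieCharExpansionAtOneOfDistribution

/-! ## §1  Neighbourhoods of `c(Y₀) ∈ GL_N(F)` pulled back along the Cayley map -/

section Cayley

variable {F : Type*} [Field F] [ValuativeRel F] [TopologicalSpace F] [IsNonarchimedeanLocalField F] {N : ℕ}

/-- **Pull-back of a neighbourhood of `c(Y₀) ∈ GL_N(F)` along the Cayley map** (`1 ± Y₀` invertible, `g₀ = (1+Y₀)(1−Y₀)⁻¹`): for `W ∈ 𝓝 g₀` there is `V' ∈ 𝓝 Y₀` such that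
every `g ∈ GL_N(F)` with `g = (1+Y)(1−Y)⁻¹`, `Y ∈ V'`, `1 ± Y` invertible, lies in `W`.  (The topology of `GL_N = M_N^×` is induced by `g ↦ (g, g⁻¹)`, `g⁻¹ = (1−Y)(1+Y)⁻¹`,
and matrix inversion is continuous at the invertible `1 ± Y₀`.)  The general-base-point form of ★ `cayley_mem_nhds_one`. [cite: PlatonovRapinchuk1994, §3.3] -/
theorem cayley_mem_nhds {Y₀ : Matrix (Fin N) (Fin N) F} (h1 : IsUnit (1 - Y₀)) (h2 : IsUnit (1 + Y₀)) {g₀ : GL (Fin N) F}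
    (hg₀ : (g₀ : Matrix (Fin N) (Fin N) F) = (1 + Y₀) * (1 - Y₀)⁻¹) {W : Set (GL (Fin N) F)} (hW : W ∈ 𝓝 g₀) :
    ∃ V' : Set (Matrix (Fin N) (Fin N) F), V' ∈ 𝓝 Y₀ ∧ ∀ g : GL (Fin N) F, ∀ Y ∈ V',
      IsUnit (1 - Y) → IsUnit (1 + Y) → (g : Matrix (Fin N) (Fin N) F) = (1 + Y) * (1 - Y)⁻¹ → g ∈ W := by
  haveI : T2Space F := (isLocalField F).toT2Space
  -- `g⁻¹ = (1−Y)(1+Y)⁻¹` for a Cayley element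
  have hinv : ∀ (g : GL (Fin N) F) (Y : Matrix (Fin N) (Fin N) F), IsUnit (1 - Y) → IsUnit (1 + Y) →
      (g : Matrix (Fin N) (Fin N) F) = (1 + Y) * (1 - Y)⁻¹ → ((g⁻¹ : GL (Fin N) F) : Matrix (Fin N) (Fin N) F) = (1 - Y) * (1 + Y)⁻¹ := by
    intro g Y hY1 hY2 hg
    refine Units.inv_eq_of_mul_eq_one_right ?_
    rw [hg, Matrix.mul_assoc, ← Matrix.mul_assoc ((1 - Y)⁻¹), Matrix.nonsing_inv_mul _ ((Matrix.isUnit_iff_isUnit_det _).1 hY1), Matrix.one_mul,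
      Matrix.mul_nonsing_inv _ ((Matrix.isUnit_iff_isUnit_det _).1 hY2)]
  -- the units topology is induced by `embedProduct : g ↦ (g, op g⁻¹)`
  rw [Units.isInducing_embedProduct.nhds_eq_comap, Filter.mem_comap] at hW
  obtain ⟨S, hS, hSW⟩ := hW
  rw [Units.embedProduct_apply, hinv g₀ Y₀ h1 h2 hg₀, hg₀, mem_nhds_prod_iff] at hS
  obtain ⟨U₁, hU₁, U₂, hU₂, hUS⟩ := hS
  -- continuity at `Y₀` of the Cayley map and of its inverse companion
  have hinvAt : ∀ A : Matrix (Fin N) (Fin N) F, IsUnit A → ContinuousAt Inv.inv A := by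
    intro A hA
    refine continuousAt_matrix_inv _ ?_
    rw [Ring.inverse_eq_inv']
    exact continuousAt_inv₀ (isUnit_iff_ne_zero.1 ((Matrix.isUnit_iff_isUnit_det _).1 hA))
  have hsub : ContinuousAt (fun Y : Matrix (Fin N) (Fin N) F => (1 - Y)⁻¹) Y₀ :=
    ContinuousAt.comp (g := Inv.inv) (f := fun Y : Matrix (Fin N) (Fin N) F => 1 - Y) (hinvAt _ h1) (continuousAt_const.sub continuousAt_id)
  have hadd : ContinuousAt (fun Y : Matrix (Fin N) (Fin N) F => (1 + Y)⁻¹) Y₀ :=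
    ContinuousAt.comp (g := Inv.inv) (f := fun Y : Matrix (Fin N) (Fin N) F => 1 + Y) (hinvAt _ h2) (continuousAt_const.add continuousAt_id)
  have hc1 : ContinuousAt (fun Y : Matrix (Fin N) (Fin N) F => (1 + Y) * (1 - Y)⁻¹) Y₀ := (continuousAt_const.add continuousAt_id).mul hsub
  have hc2 : ContinuousAt (fun Y : Matrix (Fin N) (Fin N) F => MulOpposite.op ((1 - Y) * (1 + Y)⁻¹)) Y₀ :=
    MulOpposite.continuous_op.continuousAt.comp ((continuousAt_const.sub continuousAt_id).mul hadd)
  refine ⟨(fun Y : Matrix (Fin N) (Fin N) F => (1 + Y) * (1 - Y)⁻¹) ⁻¹' U₁ ∩ (fun Y => MulOpposite.op ((1 - Y) * (1 + Y)⁻¹)) ⁻¹' U₂,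
    Filter.inter_mem (hc1.preimage_mem_nhds hU₁) (hc2.preimage_mem_nhds hU₂), ?_⟩
  intro g Y hY hY1 hY2 hg
  refine hSW ?_
  rw [Set.mem_preimage, Units.embedProduct_apply, hinv g Y hY1 hY2 hg, hg]
  exact hUS ⟨hY.1, hY.2⟩

end Cayley

/-! ## §2  The letter (LAU-pt): pointwise (L-A_U)′ from the distributional identity, every `N` -/

set_option maxHeartbeats 1600000 in
set_option synthInstance.maxHeartbeats 400000 in
open scoped Classical in
open MeasureTheory.Measure Filter Topology Polynomial Literature.NumberTheory.GaloisRepresentations.IsNonarchimedeanLocalField Summit.HodgeConjecture.HodgeConjecture.Cruxes.H413.K2E3LieUnitary in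
/-- **LETTER (LAU-pt) — from the DISTRIBUTIONAL (L-A_U)′ identity on an open Cayley domain `V` to the POINTWISE identity `Θ₀(c(Y)) = F_T(Y)` at every regular
`Y ∈ 𝔲 ∩ V` with `1 ± Y` invertible, every `N`** — the statement of PART «LIE3b» ED. 1 `U12Characters.sig_K2E3ULieCharExpansionAtOneOfDistribution` BYTE FOR BYTE.
Proof: with `Θ𝔤 := Y ↦ Θ₀(g_Y)` on `V` (`g_Y ∈ U(σ_w,H_w)(L_w)` the element with matrix `c(Y)`, chosen from the Cayley-domain clause; `0` off `V`) the AGREE clause holds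
(an element of `U` is determined by its matrix), so the distributional identity applies to every `f ∈ C_c^∞(𝔲)` supported in `V`; take `f = 1_S` for a compact open
`S ∋ Y` of `↥𝔲` (★ `exists_isCompact_isOpen_mem_subset_lie`) inside `V`, inside the constancy set of `F_T` at `Y`, and inside the pull-back (§1 `cayley_mem_nhds`) of the
constancy neighbourhood of `Θ₀` at the regular `g = c(Y)` (★ `discr_charpoly_cayley_mul_det_pow`): `μ𝔤(S)·Θ₀(g) = ∫ 1_S Θ𝔤 = T(𝓕 1_S) = ∫ 1_S F_T = μ𝔤(S)·F_T(Y)`, `0 < μ𝔤(S) < ∞`.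
[cite: HarishChandra1999AdmissibleDistributions, Thm. 16.3 p. 77, §21 p. 87] [cite: Howe1974, Prop. 3] [cite: PlatonovRapinchuk1994, §3.3] -/
theorem uLieCharExpansionAtOne_of_distribution :
    ∀ (L : Type) [Field L] [NumberField L] [IsCMField L] (N : ℕ) (H : Matrix (Fin N) (Fin N) L),
      (H.map (cmConjRingHom L))ᵀ = H → H.det ≠ 0 →
      ∀ (v : HeightOneSpectrum (𝓞 ↥(maximalRealSubfield L))) (w : UnitaryGroup.PlacesOver L v) (hw : IsCMField.complexConj L • w.1 = w.1)
      (ψ : AddChar (w.1.adicCompletion L) Circle), ψ.IsContinuousNontrivial →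
      (∃ a : w.1.adicCompletion L, galAdicCompletionMap (L := L) (IsCMField.complexConj L) hw a = a ∧ ψ a ≠ 1) →
      ∀ [MeasurableSpace ↥(lieOfForm (galAdicCompletionMap (L := L) (IsCMField.complexConj L) hw) (UnitaryGroup.placeForm H w.1))]
        [BorelSpace ↥(lieOfForm (galAdicCompletionMap (L := L) (IsCMField.complexConj L) hw) (UnitaryGroup.placeForm H w.1))]
        (μ𝔤 : Measure ↥(lieOfForm (galAdicCompletionMap (L := L) (IsCMField.complexConj L) hw) (UnitaryGroup.placeForm H w.1))) [μ𝔤.IsAddHaarMeasure]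
        [MeasurableSpace ↥(unitaryGroupOfForm (galAdicCompletionMap (L := L) (IsCMField.complexConj L) hw) (UnitaryGroup.placeForm H w.1))]
        [BorelSpace ↥(unitaryGroupOfForm (galAdicCompletionMap (L := L) (IsCMField.complexConj L) hw) (UnitaryGroup.placeForm H w.1))]
        (μ₀ : Measure ↥(unitaryGroupOfForm (galAdicCompletionMap (L := L) (IsCMField.complexConj L) hw) (UnitaryGroup.placeForm H w.1))) [μ₀.IsHaarMeasure]
        (r₀ : SmoothIrrep ↥(unitaryGroupOfForm (galAdicCompletionMap (L := L) (IsCMField.complexConj L) hw) (UnitaryGroup.placeForm H w.1))), r₀.ρ.IsAdmissible →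
        ∀ Θ₀ : ↥(unitaryGroupOfForm (galAdicCompletionMap (L := L) (IsCMField.complexConj L) hw) (UnitaryGroup.placeForm H w.1)) → ℂ,
        (∀ x₀ : ↥(unitaryGroupOfForm (galAdicCompletionMap (L := L) (IsCMField.complexConj L) hw) (UnitaryGroup.placeForm H w.1)),
          IsRegularElt (x₀ : GL (Fin N) (w.1.adicCompletion L)) → ∀ᶠ y in 𝓝 x₀, Θ₀ y = Θ₀ x₀) →
        (∀ φ₀ : ↥(unitaryGroupOfForm (galAdicCompletionMap (L := L) (IsCMField.complexConj L) hw) (UnitaryGroup.placeForm H w.1)) → ℂ,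
          IsLocSmooth φ₀ → (IrrClass.mk r₀).smoothTrace μ₀ φ₀ = ∫ x, φ₀ x * Θ₀ x ∂μ₀) →
      ∀ (V : Set (Matrix (Fin N) (Fin N) (w.1.adicCompletion L))) (T : (↥(lieOfForm (galAdicCompletionMap (L := L) (IsCMField.complexConj L) hw) (UnitaryGroup.placeForm H w.1)) → ℂ) → ℂ), IsOpen V →
        (∀ Y : ↥(lieOfForm (galAdicCompletionMap (L := L) (IsCMField.complexConj L) hw) (UnitaryGroup.placeForm H w.1)), Y.1 ∈ V → ∃ g : ↥(unitaryGroupOfForm (galAdicCompletionMap (L := L) (IsCMField.complexConj L) hw) (UnitaryGroup.placeForm H w.1)), ((g : GL (Fin N) (w.1.adicCompletion L)) : Matrix (Fin N) (Fin N) (w.1.adicCompletion L)) = (1 + Y.1) * (1 - Y.1)⁻¹) →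
        (∀ Θ𝔤 : ↥(lieOfForm (galAdicCompletionMap (L := L) (IsCMField.complexConj L) hw) (UnitaryGroup.placeForm H w.1)) → ℂ,
          (∀ (g : ↥(unitaryGroupOfForm (galAdicCompletionMap (L := L) (IsCMField.complexConj L) hw) (UnitaryGroup.placeForm H w.1))) (Y : ↥(lieOfForm (galAdicCompletionMap (L := L) (IsCMField.complexConj L) hw) (UnitaryGroup.placeForm H w.1))), Y.1 ∈ V → ((g : GL (Fin N) (w.1.adicCompletion L)) : Matrix (Fin N) (Fin N) (w.1.adicCompletion L)) = (1 + Y.1) * (1 - Y.1)⁻¹ → Θ𝔤 Y = Θ₀ g) →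
          ∀ f : ↥(lieOfForm (galAdicCompletionMap (L := L) (IsCMField.complexConj L) hw) (UnitaryGroup.placeForm H w.1)) → ℂ, IsLocSmooth f → (∀ X ∈ tsupport f, X.1 ∈ V) →
            ∫ X, f X * Θ𝔤 X ∂μ𝔤 = T (lieFourier (galAdicCompletionMap (L := L) (IsCMField.complexConj L) hw) (UnitaryGroup.placeForm H w.1) (fun x : w.1.adicCompletion L => ((ψ x : Circle) : ℂ)) μ𝔤 f)) →
        ∀ Fn : ↥(lieOfForm (galAdicCompletionMap (L := L) (IsCMField.complexConj L) hw) (UnitaryGroup.placeForm H w.1)) → ℂ,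
          (∀ f : ↥(lieOfForm (galAdicCompletionMap (L := L) (IsCMField.complexConj L) hw) (UnitaryGroup.placeForm H w.1)) → ℂ, IsLocSmooth f → T (lieFourier (galAdicCompletionMap (L := L) (IsCMField.complexConj L) hw) (UnitaryGroup.placeForm H w.1) (fun x : w.1.adicCompletion L => ((ψ x : Circle) : ℂ)) μ𝔤 f) = ∫ X, f X * Fn X ∂μ𝔤) →
          (∀ X : ↥(lieOfForm (galAdicCompletionMap (L := L) (IsCMField.complexConj L) hw) (UnitaryGroup.placeForm H w.1)), IsUnit X.1.charpoly.discr → ∀ᶠ Y in 𝓝 X, Fn Y = Fn X) →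
          ∀ g : ↥(unitaryGroupOfForm (galAdicCompletionMap (L := L) (IsCMField.complexConj L) hw) (UnitaryGroup.placeForm H w.1)), ∀ Y : ↥(lieOfForm (galAdicCompletionMap (L := L) (IsCMField.complexConj L) hw) (UnitaryGroup.placeForm H w.1)), Y.1 ∈ V → IsUnit Y.1.charpoly.discr → IsUnit (1 - Y.1) → IsUnit (1 + Y.1) →
            ((g : GL (Fin N) (w.1.adicCompletion L)) : Matrix (Fin N) (Fin N) (w.1.adicCompletion L)) = (1 + Y.1) * (1 - Y.1)⁻¹ → Θ₀ g = Fn Y := by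
  intro L _ _ _ N H _hH _hdet v w hw ψ _hψ _hψfix _ _ μ𝔤 _ _ _ μ₀ _ r₀ _hadm Θ₀ hloc _hrep V T hVo hcay hdist Fn hFn hFnloc g Y hYV hdisc h1 h2 hg
  classical
  haveI : T2Space (w.1.adicCompletion L) := (isLocalField (w.1.adicCompletion L)).toT2Space
  haveI : CharZero (w.1.adicCompletion L) := charZero_of_injective_algebraMap (algebraMap L (w.1.adicCompletion L)).injective
  -- the function `Θ𝔤 = Θ₀ ∘ c` on `𝔲 ∩ V` (by choice from the Cayley-domain clause), `0` off `V`
  let Θ𝔤 : ↥(lieOfForm (galAdicCompletionMap (L := L) (IsCMField.complexConj L) hw) (UnitaryGroup.placeForm H w.1)) → ℂ := fun Z => if h : Z.1 ∈ V then Θ₀ (Classical.choose (hcay Z h)) else 0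
  have hagree : ∀ (g' : ↥(unitaryGroupOfForm (galAdicCompletionMap (L := L) (IsCMField.complexConj L) hw) (UnitaryGroup.placeForm H w.1))) (Z : ↥(lieOfForm (galAdicCompletionMap (L := L) (IsCMField.complexConj L) hw) (UnitaryGroup.placeForm H w.1))), Z.1 ∈ V →
      ((g' : GL (Fin N) (w.1.adicCompletion L)) : Matrix (Fin N) (Fin N) (w.1.adicCompletion L)) = (1 + Z.1) * (1 - Z.1)⁻¹ → Θ𝔤 Z = Θ₀ g' := by
    intro g' Z hZ hg'
    have hsp := Classical.choose_spec (hcay Z hZ)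
    have heq : Classical.choose (hcay Z hZ) = g' := Subtype.ext (Units.ext (hsp.trans hg'.symm))
    show (if h : Z.1 ∈ V then Θ₀ (Classical.choose (hcay Z h)) else 0) = Θ₀ g'
    rw [dif_pos hZ, heq]
  -- `c(Y)` is regular, so `Θ₀` is constant near `g`
  have hgreg : IsRegularElt (g : GL (Fin N) (w.1.adicCompletion L)) := by
    rw [isRegularElt_iff_isUnit_discr, hg]
    have h := discr_charpoly_cayley_mul_det_pow Y.1 ((Matrix.isUnit_iff_isUnit_det _).1 h1)
    have h2u : IsUnit ((2 : w.1.adicCompletion L) ^ (N * (N - 1)) * Y.1.charpoly.discr) :=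
      (isUnit_iff_ne_zero.2 (pow_ne_zero _ two_ne_zero)).mul hdisc
    rw [← h] at h2u
    exact isUnit_of_mul_isUnit_left h2u
  have hW := hloc g hgreg
  rw [Filter.Eventually, nhds_subtype_eq_comap, Filter.mem_comap] at hW
  obtain ⟨W', hW', hW'W⟩ := hW
  obtain ⟨V', hV', hV'W⟩ := cayley_mem_nhds h1 h2 hg hW'
  -- the units `1 ± Z` persist near `Y`
  have ho : IsOpen {M : Matrix (Fin N) (Fin N) (w.1.adicCompletion L) | IsUnit (1 - M) ∧ IsUnit (1 + M)} := by
    have hset : {M : Matrix (Fin N) (Fin N) (w.1.adicCompletion L) | IsUnit (1 - M) ∧ IsUnit (1 + M)} =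
        {M | (1 - M).det ≠ 0} ∩ {M | (1 + M).det ≠ 0} := by
      ext M
      simp only [Set.mem_setOf_eq, Set.mem_inter_iff, Matrix.isUnit_iff_isUnit_det, isUnit_iff_ne_zero]
    rw [hset]
    exact (isOpen_ne_fun (continuous_const.sub continuous_id).matrix_det continuous_const).inter
      (isOpen_ne_fun (continuous_const.add continuous_id).matrix_det continuous_const)
  -- a compact open `S ∋ Y` of `↥𝔲` inside `V`, `V'`, the units set and the constancy set of `Fn`
  have hO : {Z : ↥(lieOfForm (galAdicCompletionMap (L := L) (IsCMField.complexConj L) hw) (UnitaryGroup.placeForm H w.1)) | Z.1 ∈ V} ∩ ({Z : ↥(lieOfForm (galAdicCompletionMap (L := L) (IsCMField.complexConj L) hw) (UnitaryGroup.placeForm H w.1)) | Z.1 ∈ V'} ∩ ({Z : ↥(lieOfForm (galAdicCompletionMap (L := L) (IsCMField.complexConj L) hw) (UnitaryGroup.placeForm H w.1)) | IsUnit (1 - Z.1) ∧ IsUnit (1 + Z.1)} ∩ {Z : ↥(lieOfForm (galAdicCompletionMap (L := L) (IsCMField.complexConj L) hw) (UnitaryGroup.placeForm H w.1)) | Fn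 Z = Fn Y})) ∈ 𝓝 Y :=
    Filter.inter_mem ((hVo.preimage continuous_subtype_val).mem_nhds hYV) (Filter.inter_mem
      (continuous_subtype_val.continuousAt.preimage_mem_nhds hV') (Filter.inter_mem ((ho.preimage continuous_subtype_val).mem_nhds ⟨h1, h2⟩) (hFnloc Y hdisc)))
  obtain ⟨S, hSc, hSo, hYS, hSO⟩ := exists_isCompact_isOpen_mem_subset_lie L N v w hw H Y hO
  -- both sides are constant on `S`
  have hΘS : ∀ Z ∈ S, Θ𝔤 Z = Θ₀ g := by
    intro Z hZ
    obtain ⟨hZV, hZV', ⟨hZ1, hZ2⟩, -⟩ := hSO hZ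
    obtain ⟨gZ, hgZ⟩ := hcay Z hZV
    rw [hagree gZ Z hZV hgZ]
    exact hW'W (hV'W (gZ : GL (Fin N) (w.1.adicCompletion L)) Z.1 hZV' hZ1 hZ2 hgZ)
  have hFnS : ∀ Z ∈ S, Fn Z = Fn Y := fun Z hZ => (hSO hZ).2.2.2
  -- test the distributional identity against `1_S`
  have hφ : IsLocSmooth (S.indicator fun _ => (1 : ℂ)) := isLocSmooth_indicator hSo hSc.isClosed hSc
  have hsupp : ∀ X ∈ tsupport (S.indicator fun _ => (1 : ℂ)), X.1 ∈ V := by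
    intro X hX
    have hXS : X ∈ S := (closure_minimal Set.support_indicator_subset hSc.isClosed) hX
    exact (hSO hXS).1
  have h := (hdist Θ𝔤 hagree _ hφ hsupp).trans (hFn _ hφ)
  rw [integral_indicator_one_mul_eq_of_eqOn μ𝔤 hSo.measurableSet Θ𝔤 (Θ₀ g) hΘS,
    integral_indicator_one_mul_eq_of_eqOn μ𝔤 hSo.measurableSet Fn (Fn Y) hFnS] at h
  have h3 : (μ𝔤.real S : ℂ) ≠ 0 := by
    rw [Complex.ofReal_ne_zero, measureReal_def]
    exact (ENNReal.toReal_pos ((hSo.measure_pos μ𝔤 ⟨Y, hYS⟩).ne') hSc.measure_lt_top.ne).ne'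
  exact mul_left_cancel₀ h3 h

end Summit.HodgeConjecture.HodgeConjecture.Cruxes.H413.K2E3ULieCharExpansionAtOneOfDistribution

end
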